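import Mathlib
import Summits.MatrixMultiplication.MatrixMultiplication.Theorems.FidelityWitnessesFidelityThesisSepMajorantSingleProduct

/-!
# Line `separable-majorant` for crux `FidelityWitnesses.FidelityThesis` (stmt-MatrixMultiplication-4956) —
stub `stub_sliceEliminationN`: EXACT OUTPUT ELIMINATION, general `n`

Slots `a = (κ,ν)` (output), `b`, `c` in `Fin n × Fin n`;
`matMulTensor ℂ n n n a b c = [a.1 = b.1 ∧ b.2 = c.1 ∧ a.2 = c.2]`.  For `S = Σ_{l<r} w_l ⊗ u_l ⊗ v_l` whose
input products are expanded in an orthonormal `d`-frame `e` of `ℂ^{n×n} ⊗ ℂ^{n×n}` (inner product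
`⟨f, g⟩ = Σ conj f · g`), `u_l ⊗ v_l = Σ_s co_{l,s} e_s` (hypotheses `he`, `hco`), write
`τ_{s,a} := Σ_m e_s (a.1,m) (m,a.2)` and `cap e := Σ_s Σ_a |τ_{s,a}|²` (`= tr (P_E W_n)`).  Then

  `|⟨S, ⟨n,n,n⟩⟩|² ≤ ‖S‖² · cap e`.

Proof (orthonormal expansion + Cauchy–Schwarz), ported from the kernel-checked general-`n` proof
`sliceElimination` of `Cruxes/DiagonalPowerDecay/Lines/frame_negativity_singlet_fraction.lean` with the
span-membership hypothesis replaced by the explicit coefficients: the output slice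
`y_a(b,c) = Σ_l w_l(a) u_l(b) v_l(c)` equals `Σ_s d'_{a,s} e_s(b,c)` with `d'_{a,s} := Σ_l w_l(a) co_{l,s}`
(`sepMajorantSE_slice_expansion`); its pairing with the slice `⟨n,n,n⟩(a,·,·)` is `Σ_s d'_{a,s} τ_{s,a}`
(toolkit `sepMajorant_slice_sum_matMulTensor`); orthonormality gives Parseval
`Σ_{b,c} |Σ_s d'_{a,s} e_s(b,c)|² = Σ_s |d'_{a,s}|²` (`sepMajorantSE_parseval`); and Cauchy–Schwarz over the
finite index set `(a,s)` (`sepMajorantSE_cauchySchwarz_pair`, from toolkit `sepMajorant_cauchySchwarz`)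
finishes.  Supports item `stmt-MatrixMultiplication-4956`; no definitions; imports toolkit I only.
-/

namespace Summit.MatrixMultiplication.MatrixMultiplication.Theorems

open scoped BigOperators ComplexConjugate
open Literature.Computability.AlgebraicComplexity

/-- Coefficient identification in an orthonormal `d`-frame `e` of `ℂ^{n×n} ⊗ ℂ^{n×n}` (for
`⟨f, g⟩ = Σ conj f · g`): `⟨e_t, Σ_s γ_s e_s⟩ = γ_t`. [folklore] -/
theorem sepMajorantSE_frame_coefficient {n d : ℕ} (e : Fin d → (Fin n × Fin n) → (Fin n × Fin n) → ℂ)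
    (he : ∀ s t : Fin d, (∑ b, ∑ c, conj (e s b c) * e t b c) = if s = t then 1 else 0)
    (γ : Fin d → ℂ) (t : Fin d) :
    ∑ b, ∑ c, conj (e t b c) * ∑ s, γ s * e s b c = γ t := by
  -- adapted from `inner_frame_slice` (Cruxes/DiagonalPowerDecay/Lines/frame_negativity_singlet_fraction.lean)
  calc ∑ b, ∑ c, conj (e t b c) * ∑ s, γ s * e s b c
      = ∑ b, ∑ c, ∑ s, γ s * (conj (e t b c) * e s b c) := by
        refine Finset.sum_congr rfl fun b _ => Finset.sum_congr rfl fun c _ => ?_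
        rw [Finset.mul_sum]
        exact Finset.sum_congr rfl fun s _ => by ring
    _ = ∑ b, ∑ s, ∑ c, γ s * (conj (e t b c) * e s b c) :=
        Finset.sum_congr rfl fun b _ => Finset.sum_comm
    _ = ∑ s, ∑ b, ∑ c, γ s * (conj (e t b c) * e s b c) := Finset.sum_comm
    _ = ∑ s, γ s * ∑ b, ∑ c, conj (e t b c) * e s b c := by
        refine Finset.sum_congr rfl fun s _ => ?_
        rw [Finset.mul_sum]
        exact Finset.sum_congr rfl fun b _ => by rw [Finset.mul_sum]
    _ = ∑ s, γ s * (if t = s then 1 else 0) := by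
        refine Finset.sum_congr rfl fun s _ => ?_
        rw [he t s]
    _ = γ t := by simp

/-- Parseval inside the span of an orthonormal `d`-frame `e` of `ℂ^{n×n} ⊗ ℂ^{n×n}`:
`Σ_{b,c} |Σ_s γ_s e_s(b,c)|² = Σ_s |γ_s|²`. [folklore] -/
theorem sepMajorantSE_parseval {n d : ℕ} (e : Fin d → (Fin n × Fin n) → (Fin n × Fin n) → ℂ)
    (he : ∀ s t : Fin d, (∑ b, ∑ c, conj (e s b c) * e t b c) = if s = t then 1 else 0)
    (γ : Fin d → ℂ) :
    ∑ b, ∑ c, ‖∑ s, γ s * e s b c‖ ^ 2 = ∑ s, ‖γ s‖ ^ 2 := by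
  -- adapted from `parseval_slice` (Cruxes/DiagonalPowerDecay/Lines/frame_negativity_singlet_fraction.lean)
  have hFc : ∀ b c : Fin n × Fin n, conj (∑ s, γ s * e s b c) = ∑ s, conj (γ s) * conj (e s b c) := by
    intro b c
    rw [map_sum]
    exact Finset.sum_congr rfl fun s _ => by rw [map_mul]
  have hC : (∑ b, ∑ c, conj (∑ s, γ s * e s b c) * ∑ s, γ s * e s b c) = ∑ s, conj (γ s) * γ s := by
    calc ∑ b, ∑ c, conj (∑ s, γ s * e s b c) * ∑ s, γ s * e s b c
        = ∑ b, ∑ c, ∑ t, conj (γ t) * (conj (e t b c) * ∑ s, γ s * e s b c) := by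
          refine Finset.sum_congr rfl fun b _ => Finset.sum_congr rfl fun c _ => ?_
          rw [hFc b c, Finset.sum_mul]
          exact Finset.sum_congr rfl fun t _ => by ring
      _ = ∑ b, ∑ t, ∑ c, conj (γ t) * (conj (e t b c) * ∑ s, γ s * e s b c) :=
          Finset.sum_congr rfl fun b _ => Finset.sum_comm
      _ = ∑ t, ∑ b, ∑ c, conj (γ t) * (conj (e t b c) * ∑ s, γ s * e s b c) := Finset.sum_comm
      _ = ∑ t, conj (γ t) * ∑ b, ∑ c, conj (e t b c) * ∑ s, γ s * e s b c := by
          refine Finset.sum_congr rfl fun t _ => ?_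
          rw [Finset.mul_sum]
          exact Finset.sum_congr rfl fun b _ => by rw [Finset.mul_sum]
      _ = ∑ t, conj (γ t) * γ t :=
          Finset.sum_congr rfl fun t _ => by rw [sepMajorantSE_frame_coefficient e he γ t]
  simp_rw [Complex.conj_mul'] at hC
  exact_mod_cast hC

/-- Cauchy–Schwarz over the pair index `(a, s)`, `a : Fin n × Fin n` an output slot and `s : Fin d` a frame
index: `|Σ_{a,s} C Z|² ≤ (Σ_{a,s} |C|²) (Σ_{a,s} |Z|²)`. [folklore] -/
theorem sepMajorantSE_cauchySchwarz_pair {n d : ℕ} (C Z : (Fin n × Fin n) → Fin d → ℂ) :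
    ‖∑ a, ∑ s, C a s * Z a s‖ ^ 2 ≤ (∑ a, ∑ s, ‖C a s‖ ^ 2) * ∑ a, ∑ s, ‖Z a s‖ ^ 2 := by
  -- adapted from `norm_sum_sum_mul_sq_le` (Cruxes/DiagonalPowerDecay/Lines/frame_negativity_singlet_fraction.lean)
  have h := sepMajorant_cauchySchwarz (fun p : (Fin n × Fin n) × Fin d => C p.1 p.2) (fun p => Z p.1 p.2)
  rw [Fintype.sum_prod_type (f := fun p : (Fin n × Fin n) × Fin d => C p.1 p.2 * Z p.1 p.2),
    Fintype.sum_prod_type (f := fun p : (Fin n × Fin n) × Fin d => ‖C p.1 p.2‖ ^ 2),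
    Fintype.sum_prod_type (f := fun p : (Fin n × Fin n) × Fin d => ‖Z p.1 p.2‖ ^ 2)] at h
  exact h

/-- Coefficients of the output slices: if every input product expands as `u_l ⊗ v_l = Σ_s co_{l,s} e_s`, then
the output slice `y_a = Σ_l w_l(a) u_l ⊗ v_l` of `S = Σ_l w_l ⊗ u_l ⊗ v_l` expands as
`y_a = Σ_s (Σ_l w_l(a) co_{l,s}) e_s`. [folklore] -/
theorem sepMajorantSE_slice_expansion {n r d : ℕ} (w u v : Fin r → Fin n × Fin n → ℂ)
    (e : Fin d → Fin n × Fin n → Fin n × Fin n → ℂ) (co : Fin r → Fin d → ℂ)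
    (hco : ∀ (l : Fin r) (b c : Fin n × Fin n), u l b * v l c = ∑ s, co l s * e s b c)
    (a b c : Fin n × Fin n) :
    ∑ l, w l a * u l b * v l c = ∑ s, (∑ l, w l a * co l s) * e s b c := by
  calc ∑ l, w l a * u l b * v l c = ∑ l, ∑ s, w l a * co l s * e s b c := by
        refine Finset.sum_congr rfl fun l _ => ?_
        rw [mul_assoc, hco l b c, Finset.mul_sum]
        exact Finset.sum_congr rfl fun s _ => by ring
    _ = ∑ s, ∑ l, w l a * co l s * e s b c := Finset.sum_comm
    _ = ∑ s, (∑ l, w l a * co l s) * e s b c :=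
        Finset.sum_congr rfl fun s _ => by rw [Finset.sum_mul]

/-- **Slice elimination (exact output elimination), general `n`.**  For `S = Σ_{l<r} w_l ⊗ u_l ⊗ v_l` whose input
products lie in the span of an orthonormal `d`-frame `e` of `ℂ^{n×n} ⊗ ℂ^{n×n}` (`u_l ⊗ v_l = Σ_s co_{l,s} e_s`):
`|Σ_{a,b,c} S(a,b,c) ⟨n,n,n⟩(a,b,c)|² ≤ ‖S‖² · Σ_s Σ_a |Σ_m e_s (a.1,m) (m,a.2)|²` (`= ‖S‖² · cap e`).
Proof: expand the output slices `S(a,·,·) = Σ_s d'_{a,s} e_s` (`sepMajorantSE_slice_expansion`); the slice pairing is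
`Σ_s d'_{a,s} τ_{s,a}` (`sepMajorant_slice_sum_matMulTensor`), `Σ_{b,c} |S(a,b,c)|² = Σ_s |d'_{a,s}|²`
(`sepMajorantSE_parseval`), and Cauchy–Schwarz over `(a,s)` (`sepMajorantSE_cauchySchwarz_pair`). [folklore] -/
theorem stub_sliceEliminationN {n r d : ℕ} (w u v : Fin r → Fin n × Fin n → ℂ)
    (e : Fin d → Fin n × Fin n → Fin n × Fin n → ℂ)
    (he : ∀ s t : Fin d, (∑ b, ∑ c, conj (e s b c) * e t b c) = if s = t then 1 else 0)
    (co : Fin r → Fin d → ℂ) (hco : ∀ (l : Fin r) (b c : Fin n × Fin n), u l b * v l c = ∑ s, co l s * e s b c) :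
    ‖∑ a, ∑ b, ∑ c, (∑ l, w l a * u l b * v l c) * matMulTensor ℂ n n n a b c‖ ^ 2 ≤
      (∑ a, ∑ b, ∑ c, ‖∑ l, w l a * u l b * v l c‖ ^ 2) *
        ∑ s, ∑ a : Fin n × Fin n, ‖∑ m : Fin n, e s (a.1, m) (m, a.2)‖ ^ 2 := by
  -- adapted from `sliceElimination` (Cruxes/DiagonalPowerDecay/Lines/frame_negativity_singlet_fraction.lean)
  -- coefficients of the output slices in the frame: `d' a s = Σ_l w l a * co l s`
  have hexp : ∀ a b c : Fin n × Fin n, ∑ l, w l a * u l b * v l c = ∑ s, (∑ l, w l a * co l s) * e s b c :=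
    sepMajorantSE_slice_expansion w u v e co hco
  -- the pairing, slice by slice
  have hL : ∑ a, ∑ b, ∑ c, (∑ l, w l a * u l b * v l c) * matMulTensor ℂ n n n a b c
      = ∑ a : Fin n × Fin n, ∑ s, (∑ l, w l a * co l s) * ∑ m : Fin n, e s (a.1, m) (m, a.2) := by
    refine Finset.sum_congr rfl fun a _ => ?_
    rw [sepMajorant_slice_sum_matMulTensor (fun b c => ∑ l, w l a * u l b * v l c) a]
    calc ∑ m : Fin n, ∑ l, w l a * u l (a.1, m) * v l (m, a.2)
        = ∑ m : Fin n, ∑ s, (∑ l, w l a * co l s) * e s (a.1, m) (m, a.2) :=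
          Finset.sum_congr rfl fun m _ => hexp a _ _
      _ = ∑ s, ∑ m : Fin n, (∑ l, w l a * co l s) * e s (a.1, m) (m, a.2) := Finset.sum_comm
      _ = ∑ s, (∑ l, w l a * co l s) * ∑ m : Fin n, e s (a.1, m) (m, a.2) :=
          Finset.sum_congr rfl fun s _ => by rw [Finset.mul_sum]
  -- Parseval, slice by slice
  have hR : ∑ a, ∑ b, ∑ c, ‖∑ l, w l a * u l b * v l c‖ ^ 2
      = ∑ a : Fin n × Fin n, ∑ s, ‖∑ l, w l a * co l s‖ ^ 2 := by
    refine Finset.sum_congr rfl fun a _ => ?_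
    calc ∑ b, ∑ c, ‖∑ l, w l a * u l b * v l c‖ ^ 2
        = ∑ b, ∑ c, ‖∑ s, (∑ l, w l a * co l s) * e s b c‖ ^ 2 :=
          Finset.sum_congr rfl fun b _ => Finset.sum_congr rfl fun c _ => by rw [hexp a b c]
      _ = ∑ s, ‖∑ l, w l a * co l s‖ ^ 2 := sepMajorantSE_parseval e he fun s => ∑ l, w l a * co l s
  rw [hL, hR, Finset.sum_comm (f := fun s (a : Fin n × Fin n) => ‖∑ m : Fin n, e s (a.1, m) (m, a.2)‖ ^ 2)]
  exact sepMajorantSE_cauchySchwarz_pair (fun a s => ∑ l, w l a * co l s)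
    fun a s => ∑ m : Fin n, e s (a.1, m) (m, a.2)

end Summit.MatrixMultiplication.MatrixMultiplication.Theorems
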